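import Summits.RiemannHypothesis.RiemannHypothesis.Theses.OddSector
import Literature.NumberTheory.LFunctions.WeilExplicit
import Literature.NumberTheory.LFunctions.YoshidaOddCriterion
import Literature.NumberTheory.LFunctions.UniformWeilPositivityRH
import Literature.NumberTheory.LFunctions.WeilSmallSupportPositivity
import Literature.NumberTheory.LFunctions.WeilGroundEnergyProofs
import Literature.NumberTheory.LFunctions.WeilMellinBounds
import HarnessLib

/-!
# Disproof of `OddNegativityOffLine` (stmt-RiemannHypothesis-17780) — standing adversary, cycle 1

Crux of route OddSector (rank 4), READ BACK (`oddNegativityOffLine_iff`, by `Iff.rfl`: the rev-1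
let-inlined functional `Q` = polar − prime + archimedean IS `Literature…weilQuadratic`, and
`ContDiff ℝ ∞ ∧ HasCompactSupport` IS `IsWeilTest`):

  `¬ RiemannHypothesis → ∃ η > 0, ∃ A, ∀ a ≥ A, NegWindow η a`,

where `NegWindow η a` (below) says: window `[-a, a]` carries an `L²`-normalised smooth ODD test `h`
with `Re Q(h) ≤ -η`.

## Findings (cycle 1, 2026-08-17)

* NO KILL — AND NONE CAN EXIST: the crux is a THEOREM of today's tree. `SketchIdeator2.lean` in this
  crux directory proves the route decl BY NAME from the landed odd-sector Weil criterion
  `RuelleBandExactFirstBand.stub_oddSectorCriterion` + `riemannZeta_ofReal_ne_zero_of_pos_of_lt_one`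
  + `riemannHypothesis_iff_strip_holds`; re-checked by this seat today: rc 0, 0 sorries, axioms
  {propext, Classical.choice, Quot.sound}, audit proof-of-item closed=true (5 candidate proofs sit on
  the item as evidence). Independently of that, `¬(¬RH → X) = ¬RH ∧ ¬X`: an unconditional refutation
  would contain a disproof of RH.
* SHAPE (§1, kernel-checked): window-uniformity and normalisation are DECORATION —
  `crux ↔ (¬RH → ∃ odd test g, Re Q g < 0)` (`oddNegativityOffLine_iff_exists_odd_neg`), i.e. the crux
  is literally Yoshida 1992 Prop. 1(1) "only if" for `k = ℚ` (one witness serves every larger window by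
  support inclusion, `negWindow_mono`; `Q(c g) = |c|² Q(g)` normalises, `weilQuadratic_const_mul`).
* LOAD-BEARING HYPOTHESIS (§2): the crux has ONE hypothesis, `¬RH`, and it is load-bearing in the
  strongest possible sense: with it deleted the statement is EQUIVALENT TO `¬RH`
  (`withoutNotRH_iff_not_riemannHypothesis`; the forward half `withoutNotRH_imp_not_riemannHypothesis`
  is unconditional, by the easy half of Weil's criterion `yoshida_odd_criterion_mp`). Consequently the
  protocol's `oddNegativityOffLine_false_without_notRH : ¬ OddNegativityOffLineWithoutNotRH` would be
  a PROOF OF RH (`false_without_notRH_iff_riemannHypothesis`) — not landable; recorded, not attempted.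
* TIGHTNESS of the window threshold (§3, unconditional): a window carrying ANY test of negative Weil
  energy has radius `> (log 2)/2` (Yoshida 1992 Thm 1, in tree as `weilPositivityOn_of_le_log_two_half`):
  `radius_gt_of_neg_energy`, `negWindow_radius_gt`; hence EVERY admissible threshold of the crux has
  `A > (log 2)/2 > 0.3465` (`threshold_gt_log_two_half`, `threshold_gt_numeric`). The witness window is
  a function of the off-line zero; nothing window-universal can be extracted from the crux.
* NATURAL STRENGTHENINGS (§4): deleting the threshold ("EVERY window `a > 0` carries a negative odd
  test", with `η` uniform OR per window) gives statements EQUIVALENT TO RH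
  (`everyWindow_iff_riemannHypothesis`, `everyWindowLocal_iff_riemannHypothesis`) — true iff vacuous,
  circular as a route step; their unguarded forms are FALSE outright (`not_everyWindow_unguarded`,
  `not_everyWindowLocal_unguarded`, witness window `a = (log 2)/2`). NOT attack surfaces (true, hence
  recorded only): the REAL-valued-witness strengthening (ideator 2's `oddRealNegativityOffLine`,
  proved) and "η arbitrarily large under ¬RH" (`∀ M, ∃ A, ∀ a ≥ A, NegWindow M a`: the Landau engine
  behind `stub_oddSectorCriterion` makes `Re B_g` unbounded below, so `Re Q` of the normalised odd
  symmetric translates `(g(·-x)+g(·+x))/√2` is unbounded below as `x → ∞`).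
* JUNK AUDIT (§5): nothing bites — `Λ 0 = Λ 1 = 0` kill the `n = 0, 1` terms of the inlined prime
  `tsum` (where `Real.sqrt 0 = 0`, `Real.log 0 = Real.log 1 = 0` would otherwise be junk), the sum is
  finite for compactly supported `h`, the archimedean integrand is (Schwartz) × (log-growth); degenerate
  windows `a ≤ 0` carry no normalised test at all and are excluded by §3 anyway.
* `-- Targets`: none this cycle (payload.stuck_stubs = [], no line picked).

## Why it resists
It is proved (sorry-free, standard axioms). The recorded "why it might fail" of the item — a mismatch
between Yoshida's test class and `IsWeilTest` at the normalisation step — does not arise: Yoshida's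
class is never used (the tree's own odd criterion is over `IsWeilTest`, closed under `c • ·`).

## What a later seat could still do here
Nothing adversarial. If the lead ever registers stubs for a line on this crux, the honest cut is the
two theorems of `SketchIdeator2.lean`, both already proved; a `stub_*_false` target cannot exist.
-/

noncomputable section

-- D-0017: single-problem summit ⇒ `Summit.RiemannHypothesis.RiemannHypothesis.…` by design.
set_option linter.dupNamespace false

open Set MeasureTheory Filter
open scoped Real Topology ComplexConjugate

namespace Summit.RiemannHypothesis.RiemannHypothesis.Cruxes.OddNegativityOffLine.Disproof

open Literature.NumberTheory.LFunctions

/-! ## 0. Vocabulary and read-back -/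

/-- Window `[-a, a]` carries an `L²`-normalised smooth ODD test function of Weil energy `≤ -η`
(the matrix of the crux's conclusion, Literature vocabulary). -/
def NegWindow (η a : ℝ) : Prop :=
  ∃ h : ℝ → ℂ, IsWeilTest h ∧ tsupport h ⊆ Icc (-a) a ∧ (∀ t, h (-t) = -h t) ∧
    ∫ t, ‖h t‖ ^ 2 = (1 : ℝ) ∧ (weilQuadratic h).re ≤ -η

/-- The crux with its only hypothesis `¬RH` DELETED (= its conclusion). -/
def OddNegativityOffLineWithoutNotRH : Prop :=
  ∃ η : ℝ, 0 < η ∧ ∃ A : ℝ, ∀ a : ℝ, A ≤ a → NegWindow η a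

/-- READ-BACK: the route decl (rev 1, Mathlib primitives, `let`-inlined `C`, `M`, `Q`) is
DEFINITIONALLY `¬RH → OddNegativityOffLineWithoutNotRH` over the Literature vocabulary
(`IsWeilTest`, `weilQuadratic`). -/
theorem oddNegativityOffLine_iff :
    Summit.RiemannHypothesis.RiemannHypothesis.Theses.OddSector.OddNegativityOffLine ↔
      (¬ RiemannHypothesis → OddNegativityOffLineWithoutNotRH) :=
  Iff.rfl

/-! ## 1. Shape: window-uniformity and normalisation are decoration -/

/-- Support inclusion: a witness at window `a` is a witness at every window `b ≥ a`. -/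
theorem negWindow_mono {η a b : ℝ} (hab : a ≤ b) (h : NegWindow η a) : NegWindow η b := by
  obtain ⟨g, hg, hsupp, hodd, hnorm, hQ⟩ := h
  exact ⟨g, hg, hsupp.trans (Icc_subset_Icc (neg_le_neg hab) hab), hodd, hnorm, hQ⟩

/-- Weakening `η`. -/
theorem negWindow_anti {η η' a : ℝ} (hη : η' ≤ η) (h : NegWindow η a) : NegWindow η' a := by
  obtain ⟨g, hg, hsupp, hodd, hnorm, hQ⟩ := h
  exact ⟨g, hg, hsupp, hodd, hnorm, by linarith⟩

/-- `∀ a ≥ A` is decoration: the conclusion is equivalent to ONE window carrying a witness. -/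
theorem withoutNotRH_iff_exists_window :
    OddNegativityOffLineWithoutNotRH ↔ ∃ η : ℝ, 0 < η ∧ ∃ A : ℝ, NegWindow η A := by
  constructor
  · rintro ⟨η, hη, A, hA⟩
    exact ⟨η, hη, A, hA A le_rfl⟩
  · rintro ⟨η, hη, A, hA⟩
    exact ⟨η, hη, A, fun a ha => negWindow_mono ha hA⟩

/-- Normalisation and windows are decoration: the conclusion is equivalent to the existence of ONE
smooth compactly supported odd `g` with `Re Q(g) < 0` (Yoshida's printed shape). Proof of `←` as in
`SketchIdeator2.lean`: `g ≠ 0` since `Q(0) = 0`; `c = ‖g‖₂⁻¹`, `Q(c g) = c² Q(g)`; `A :=` a support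
radius. -/
theorem withoutNotRH_iff_exists_odd_neg :
    OddNegativityOffLineWithoutNotRH ↔
      ∃ g : ℝ → ℂ, IsWeilTest g ∧ (∀ t, g (-t) = -g t) ∧ (weilQuadratic g).re < 0 := by
  constructor
  · rintro ⟨η, hη, A, hA⟩
    obtain ⟨g, hg, -, hodd, -, hQ⟩ := hA A le_rfl
    exact ⟨g, hg, hodd, by linarith⟩
  · rintro ⟨g, hg, hodd, hneg⟩
    have hN2nn : 0 ≤ ∫ t : ℝ, ‖g t‖ ^ 2 := integral_nonneg fun _ => by positivity
    have hpos : 0 < ∫ t : ℝ, ‖g t‖ ^ 2 := by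
      rcases hN2nn.eq_or_lt with hz | hpos
      · exfalso
        have hg0 : g = 0 := hg.eq_zero_of_integral_norm_sq_eq_zero hz.symm
        subst hg0
        rw [weilQuadratic_zero, Complex.zero_re] at hneg
        exact lt_irrefl _ hneg
      · exact hpos
    set N2 : ℝ := ∫ t : ℝ, ‖g t‖ ^ 2 with hN2
    set c : ℝ := (Real.sqrt N2)⁻¹ with hc
    have hcpos : 0 < c := inv_pos.2 (Real.sqrt_pos.2 hpos)
    have hht : IsWeilTest fun t => (c : ℂ) * g t := hg.const_mul c
    have hnorm : ∫ t : ℝ, ‖(c : ℂ) * g t‖ ^ 2 = 1 := by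
      simp only [norm_mul, mul_pow, Complex.norm_real, Real.norm_of_nonneg hcpos.le]
      rw [integral_const_mul, hc, inv_pow, Real.sq_sqrt hN2nn, inv_mul_cancel₀ hpos.ne']
    have hQ : (weilQuadratic fun t => (c : ℂ) * g t).re = c * c * (weilQuadratic g).re := by
      rw [weilQuadratic_const_mul, Complex.normSq_ofReal, Complex.re_ofReal_mul]
    have hQneg : (weilQuadratic fun t => (c : ℂ) * g t).re < 0 := by
      rw [hQ]; exact mul_neg_of_pos_of_neg (mul_pos hcpos hcpos) hneg
    obtain ⟨r, hr⟩ := hg.2.isCompact.isBounded.subset_closedBall (0 : ℝ)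
    refine ⟨-(weilQuadratic fun t => (c : ℂ) * g t).re, by linarith, r, fun a ha => ?_⟩
    refine ⟨fun t => (c : ℂ) * g t, hht, ?_, fun t => ?_, hnorm, by linarith⟩
    · refine tsupport_mul_subset_right.trans (hr.trans ?_)
      rw [Real.closedBall_eq_Icc, zero_sub, zero_add]
      exact Set.Icc_subset_Icc (neg_le_neg ha) ha
    · show (c : ℂ) * g (-t) = -((c : ℂ) * g t)
      rw [hodd, mul_neg]

/-- THE CRUX IS YOSHIDA 1992 PROP. 1(1) "ONLY IF" (`k = ℚ`), verbatim up to decoration. -/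
theorem oddNegativityOffLine_iff_exists_odd_neg :
    Summit.RiemannHypothesis.RiemannHypothesis.Theses.OddSector.OddNegativityOffLine ↔
      (¬ RiemannHypothesis →
        ∃ g : ℝ → ℂ, IsWeilTest g ∧ (∀ t, g (-t) = -g t) ∧ (weilQuadratic g).re < 0) :=
  oddNegativityOffLine_iff.trans (imp_congr_right fun _ => withoutNotRH_iff_exists_odd_neg)

/-! ## 2. Load-bearing analysis: the hypothesis `¬RH` -/

/-- Unconditional: the conclusion alone REFUTES RH (easy half of Weil's criterion — under RH every
test, odd or not, has `Re Q ≥ 0`; take the witness at the threshold window `a = A`). -/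
theorem withoutNotRH_imp_not_riemannHypothesis (H : OddNegativityOffLineWithoutNotRH) :
    ¬ RiemannHypothesis := by
  intro hRH
  obtain ⟨η, hη, A, hA⟩ := H
  obtain ⟨h, hh, -, hodd, -, hQ⟩ := hA A le_rfl
  have h0 := yoshida_odd_criterion_mp hRH h hh hodd
  linarith

/-- The same, contraposed: under RH the hypothesis-free statement is false. ("Negative modulo RH" —
the `H` of the protocol would be RH itself, so this is NOT filed `--negative-modulo`.) -/
theorem riemannHypothesis_imp_not_withoutNotRH (hRH : RiemannHypothesis) :
    ¬ OddNegativityOffLineWithoutNotRH :=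
  fun H => withoutNotRH_imp_not_riemannHypothesis H hRH

/-- `¬RH` is load-bearing in the strongest sense: GIVEN THE CRUX (a theorem of the tree, landed
separately — taken here as a hypothesis so that this file proves nothing positive about a Theses decl),
deleting `¬RH` turns the statement into `¬RH` itself. -/
theorem withoutNotRH_iff_not_riemannHypothesis
    (hC : Summit.RiemannHypothesis.RiemannHypothesis.Theses.OddSector.OddNegativityOffLine) :
    OddNegativityOffLineWithoutNotRH ↔ ¬ RiemannHypothesis :=
  ⟨withoutNotRH_imp_not_riemannHypothesis, fun hRH => (oddNegativityOffLine_iff.mp hC) hRH⟩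

/-- Hence the protocol's `oddNegativityOffLine_false_without_notRH` would be a proof of the Riemann
hypothesis: not a lemma anybody lands. -/
theorem false_without_notRH_iff_riemannHypothesis
    (hC : Summit.RiemannHypothesis.RiemannHypothesis.Theses.OddSector.OddNegativityOffLine) :
    ¬ OddNegativityOffLineWithoutNotRH ↔ RiemannHypothesis := by
  rw [withoutNotRH_iff_not_riemannHypothesis hC, not_not]

/-! ## 3. Tightness: the window threshold exceeds Yoshida's radius `(log 2)/2` -/

/-- Unconditional (Yoshida 1992 Thm 1 / `weilPositivityOn_of_le_log_two_half`): a window carrying ANY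
test function of negative Weil energy — odd or not, normalised or not — has radius `> (log 2)/2`. -/
theorem radius_gt_of_neg_energy {a : ℝ} {h : ℝ → ℂ} (hh : IsWeilTest h)
    (hsupp : tsupport h ⊆ Icc (-a) a) (hQ : (weilQuadratic h).re < 0) : Real.log 2 / 2 < a := by
  by_contra hle
  have h0 := weilPositivityOn_of_le_log_two_half (not_lt.mp hle) h hh hsupp
  linarith

/-- No window of radius `≤ (log 2)/2` is a `NegWindow` (for any `η > 0`). -/
theorem not_negWindow_of_le {η a : ℝ} (hη : 0 < η) (ha : a ≤ Real.log 2 / 2) : ¬ NegWindow η a := by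
  rintro ⟨g, hg, hsupp, -, -, hQ⟩
  have := radius_gt_of_neg_energy hg hsupp (by linarith)
  linarith

/-- Every `NegWindow` has radius `> (log 2)/2`. -/
theorem negWindow_radius_gt {η a : ℝ} (hη : 0 < η) (h : NegWindow η a) : Real.log 2 / 2 < a := by
  by_contra hle
  exact not_negWindow_of_le hη (not_lt.mp hle) h

/-- TIGHTNESS OF THE THRESHOLD: every admissible `A` of the crux's conclusion exceeds `(log 2)/2`
(unconditionally; in particular `A ≤ 0`, where windows are degenerate, never occurs). -/
theorem threshold_gt_log_two_half {η A : ℝ} (hη : 0 < η)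
    (hA : ∀ a : ℝ, A ≤ a → NegWindow η a) : Real.log 2 / 2 < A :=
  negWindow_radius_gt hη (hA A le_rfl)

/-- Numeric form: `A > 0.3465`. -/
theorem threshold_gt_numeric {η A : ℝ} (hη : 0 < η)
    (hA : ∀ a : ℝ, A ≤ a → NegWindow η a) : (0.3465 : ℝ) < A := by
  have h1 := threshold_gt_log_two_half hη hA
  have h2 := Real.log_two_gt_d9
  linarith

/-! ## 4. Natural strengthenings -/

/-- STRENGTHENING S1 (threshold deleted, `η` uniform): "if RH fails, EVERY window `a > 0` carries a
normalised odd test of energy `≤ -η`". -/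
def OddNegativityEveryWindow : Prop :=
  ¬ RiemannHypothesis → ∃ η : ℝ, 0 < η ∧ ∀ a : ℝ, 0 < a → NegWindow η a

/-- STRENGTHENING S2 (threshold deleted, `η` per window). -/
def OddNegativityEveryWindowLocal : Prop :=
  ¬ RiemannHypothesis → ∀ a : ℝ, 0 < a → ∃ η : ℝ, 0 < η ∧ NegWindow η a

private theorem log_two_half_pos : (0 : ℝ) < Real.log 2 / 2 := by
  have := Real.log_two_gt_d9
  linarith

/-- S1 IS EQUIVALENT TO RH: it can only hold vacuously (window `a = (log 2)/2` is positive but carries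
no negative test), so as a route step it is circular. -/
theorem everyWindow_iff_riemannHypothesis : OddNegativityEveryWindow ↔ RiemannHypothesis := by
  constructor
  · intro H
    by_contra hRH
    obtain ⟨η, hη, hall⟩ := H hRH
    exact not_negWindow_of_le hη le_rfl (hall _ log_two_half_pos)
  · exact fun hRH hnRH => absurd hRH hnRH

/-- S2 IS EQUIVALENT TO RH as well. -/
theorem everyWindowLocal_iff_riemannHypothesis :
    OddNegativityEveryWindowLocal ↔ RiemannHypothesis := by
  constructor
  · intro H
    by_contra hRH
    obtain ⟨η, hη, hw⟩ := H hRH _ log_two_half_pos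
    exact not_negWindow_of_le hη le_rfl hw
  · exact fun hRH hnRH => absurd hRH hnRH

/-- The UNGUARDED every-window statement is false outright. -/
theorem not_everyWindow_unguarded :
    ¬ ∃ η : ℝ, 0 < η ∧ ∀ a : ℝ, 0 < a → NegWindow η a := by
  rintro ⟨η, hη, hall⟩
  exact not_negWindow_of_le hη le_rfl (hall _ log_two_half_pos)

/-- The UNGUARDED per-window statement is false outright. -/
theorem not_everyWindowLocal_unguarded :
    ¬ ∀ a : ℝ, 0 < a → ∃ η : ℝ, 0 < η ∧ NegWindow η a := by
  intro hall
  obtain ⟨η, hη, hw⟩ := hall _ log_two_half_pos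
  exact not_negWindow_of_le hη le_rfl hw

/-- For contrast, the crux's OWN unguarded form (= `OddNegativityOffLineWithoutNotRH`) is not
refutable in the tree: its negation is RH (§2). The threshold `∃ A` is exactly what separates a
theorem (`¬RH →` threshold form) from RH itself (every-window forms). -/
example (hC : Summit.RiemannHypothesis.RiemannHypothesis.Theses.OddSector.OddNegativityOffLine) :
    ¬ OddNegativityOffLineWithoutNotRH ↔ RiemannHypothesis :=
  false_without_notRH_iff_riemannHypothesis hC

/-! ## 5. Junk audit of the inlined functional (nothing bites) -/

/-- The `n = 0` and `n = 1` terms of the inlined prime sum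
`∑' n, Λ(n) n^{-1/2} (C h (log n) + C h (-log n))` vanish because `Λ 0 = Λ 1 = 0`, so the junk values
`Real.sqrt 0 = 0` (division by zero) and `Real.log 0 = Real.log 1 = 0` are never seen. -/
example : ArithmeticFunction.vonMangoldt 0 = 0 ∧ ArithmeticFunction.vonMangoldt 1 = 0 := by
  simp

example : Real.log ((0 : ℕ) : ℝ) = 0 ∧ Real.log ((1 : ℕ) : ℝ) = 0 ∧ Real.sqrt ((0 : ℕ) : ℝ) = 0 := by
  simp

/-- Degenerate windows carry nothing: for `a ≤ (log 2)/2` (in particular `a ≤ 0`, where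
`Icc (-a) a ⊆ {0}` forces `h = 0`, `‖h‖₂ = 0 ≠ 1`) there is no `NegWindow` — subsumed by §3. -/
example {η a : ℝ} (hη : 0 < η) (ha : a ≤ 0) : ¬ NegWindow η a :=
  not_negWindow_of_le hη (ha.trans log_two_half_pos.le)

/-! ## Targets
None this cycle: `payload.stuck_stubs = []`, no line picked (`PICKED.md` absent). -/

end Summit.RiemannHypothesis.RiemannHypothesis.Cruxes.OddNegativityOffLine.Disproof

end
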